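import Literature.AnabelianGeometry.SemiGraphs.TemperedVerticialCountability
import Literature.AnabelianGeometry.SemiGraphs.TemperedCoveringsTemperedLimitsProofs
import HarnessLib

/-!
# [SemiAnbd] Theorem 3.7 (i): existence of the verticial homomorphisms — reduction to
# Proposition 3.2

Mochizuki, *Semi-graphs of anabelioids*, Publ. RIMS **42** (2006), §3, manuscript p. 40
[cite: MochizukiSemiAnbd2006, Thm 3.7(i) p.40]: "For each vertex `v` of `G`, there is a natural
continuous, injective outer homomorphism `π̂₁(G_v) ↪ π₁^temp(G)`."  In the typed form
(`TemperedCoverings.lean`/`TemperedVerticial.lean`, seat abc-iut-L3-t2) the outer homomorphism is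
represented by a continuous `ψ : Π_v → π₁^temp(G)` whose pull-back functor `B^temp(ψ)` is isomorphic
to the restriction `B^temp(G) → G_v^⊤`, `S ↦ S_v`, transported along the chart (`IsVerticialHom`);
its EXISTENCE is Proposition 3.2 ("every morphism of connected temperoids
`B^temp(Π₁) → B^temp(Π₂)` is `B^temp(φ)` for a continuous `φ`", the named fact `TemperoidHomEqRes`)
applied to that restriction, which is a morphism of temperoids by brick B0
(`chartRestrictV_isTemperoidHom`, seat abc-iut-L3-d4), and `Π_v` is second countable
([IUTchI] Rmk. 2.5.3 (ii) (E7); `secondCountableTopology_Gv`).  Proof-only file recording this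
REDUCTION (`exists_isVerticialHom_of`, `verticialSubgroups_nonempty_of`) and, with the injectivity
clause (`verticialHom_injective`, `TemperedVerticialInjective.lean`), the reduction of the named fact
`VerticialInjective` to `TemperoidHomEqRes` alone (`verticialInjective_of`).  The edge analogue
(`exists_isEdgeHom_of`) is recorded for Theorem 3.7 (iii).  Nothing here takes a side on any
disputed step.
-/

open CategoryTheory CategoryTheory.Limits Topology

namespace Literature.AnabelianGeometry.SemiGraphs

namespace ProfiniteSemiGraph

universe u

variable {𝒢 : ProfiniteSemiGraph.{u}}

/-- **Theorem 3.7 (i), existence** — REDUCED to Proposition 3.2 for `(Π_v, π₁^temp(G))`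
(`TemperoidHomEqRes`): every vertex of a Galois-countable, quasi-coherent `G` carries a verticial
homomorphism `Π_v → π₁^temp(G)` ("a natural continuous … outer homomorphism
`π̂₁(G_v) → π₁^temp(G)`"). [cite: MochizukiSemiAnbd2006, Thm 3.7(i) p.40] -/
theorem exists_isVerticialHom_of (c : TemperedPiChart 𝒢) (v : 𝒢.graph.Vertex)
    (hRes : TemperoidHomEqRes (𝒢.Gv v) c.G) (hqc : 𝒢.IsQuasiCoherent) (hgc : 𝒢.IsGaloisCountable) :
    ∃ φ : 𝒢.Gv v →ₜ* c.G, IsVerticialHom c v φ := by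
  haveI : SecondCountableTopology (𝒢.Gv v) := secondCountableTopology_Gv hqc hgc v
  haveI : SecondCountableTopology c.G := c.secondCountableTopology
  obtain ⟨h₁, h₂⟩ := chartRestrictV_isTemperoidHom c v
  let Φ : TemperoidHom (BTemp (𝒢.Gv v)) (BTemp c.G) :=
    ⟨c.equiv.inverse ⋙ ObjectProperty.ι _ ⋙ restrictV 𝒢 v, h₁, h₂⟩
  obtain ⟨φ, hφ⟩ := hRes IsTempered.of_profinite c.isTempered Φ
  exact ⟨φ, hφ⟩

/-- **Theorem 3.7 (i)**: under the same inputs the verticial subgroups at `v` form a nonempty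
(conjugacy) class. [cite: MochizukiSemiAnbd2006, Thm 3.7(i) p.40] -/
theorem verticialSubgroups_nonempty_of (c : TemperedPiChart 𝒢) (v : 𝒢.graph.Vertex)
    (hRes : TemperoidHomEqRes (𝒢.Gv v) c.G) (hqc : 𝒢.IsQuasiCoherent)
    (hgc : 𝒢.IsGaloisCountable) : (verticialSubgroups c v).Nonempty := by
  obtain ⟨φ, hφ⟩ := exists_isVerticialHom_of c v hRes hqc hgc
  exact ⟨φ.toMonoidHom.range, φ, hφ, rfl⟩

/-- **Theorem 3.7 (iii) vocabulary, existence of the edge homomorphisms** — reduced likewise: for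
an edge `e` with an abutting branch (so that `Π_e ↪ Π_v` is second countable), `G` of injective
type, Galois-countable and quasi-coherent, there is `ψ : Π_e → π₁^temp(G)` with `IsEdgeHom c e ψ`,
hence the edge-like subgroups at `e` are nonempty. [cite: MochizukiSemiAnbd2006, Thm 3.7(iii) p.41] -/
theorem exists_isEdgeHom_of (c : TemperedPiChart 𝒢) (b : 𝒢.graph.Branch) (v : 𝒢.graph.Vertex)
    (h : 𝒢.graph.abuts b = some v) (hRes : TemperoidHomEqRes (𝒢.Ge (𝒢.graph.edgeOf b)) c.G)
    (hqc : 𝒢.IsQuasiCoherent) (hgc : 𝒢.IsGaloisCountable) (hinj : 𝒢.IsOfInjectiveType) :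
    ∃ φ : 𝒢.Ge (𝒢.graph.edgeOf b) →ₜ* c.G, IsEdgeHom c (𝒢.graph.edgeOf b) φ := by
  haveI : SecondCountableTopology (𝒢.Ge (𝒢.graph.edgeOf b)) :=
    secondCountableTopology_Ge hqc hgc hinj b v h
  haveI : SecondCountableTopology c.G := c.secondCountableTopology
  obtain ⟨h₁, h₂⟩ := chartRestrictE_isTemperoidHom c (𝒢.graph.edgeOf b)
  let Φ : TemperoidHom (BTemp (𝒢.Ge (𝒢.graph.edgeOf b))) (BTemp c.G) :=
    ⟨c.equiv.inverse ⋙ ObjectProperty.ι _ ⋙ restrictE 𝒢 (𝒢.graph.edgeOf b), h₁, h₂⟩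
  obtain ⟨φ, hφ⟩ := hRes IsTempered.of_profinite c.isTempered Φ
  exact ⟨φ, hφ⟩

/-- **Theorem 3.7 (i)** as typed (`VerticialInjective`: existence AND injectivity of the verticial
homomorphisms), REDUCED to Proposition 3.2 (`TemperoidHomEqRes`, all pairs of groups); the
injectivity is `verticialHom_injective`, the temperoid structure of `B^temp(G) → G_v^⊤` is brick B0.
[cite: MochizukiSemiAnbd2006, Thm 3.7(i) p.40] -/
theorem verticialInjective_of
    (hRes : ∀ (G₁ : Type u) [Group G₁] [TopologicalSpace G₁] (G₂ : Type u) [Group G₂]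
      [TopologicalSpace G₂], TemperoidHomEqRes G₁ G₂) :
    VerticialInjective.{u} :=
  verticialInjective_iff_nonempty.mpr fun _ h𝒢 c v =>
    verticialSubgroups_nonempty_of c v (hRes _ _) h𝒢.isQuasiCoherent h𝒢.isGaloisCountable

end ProfiniteSemiGraph

end Literature.AnabelianGeometry.SemiGraphs
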